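import Summits.CriticalPhenomena.PercolationContinuityZ3.Theorems.PercNearOneGluingNoHeavyLowerTailMajorityGluingQCertSym3TypeCheck
import Summits.CriticalPhenomena.PercolationContinuityZ3.Theorems.PercNearOneGluingNoHeavyLowerTailMajorityGluingQCertSym3Glue
import HarnessLib

/-!
# Type-space digests of certificate PARTS and their gluing (lane prim-rate, constants-miner 1, gen 37 → 38; census/g37/TYPE-SPACE-CHECKER.md)

Support file for the closed crux `NoHeavyLowerTail` (stmt-CriticalPhenomena-4575), majority-gluing line.  A large certificate is split into parts (same base); each part's
TYPE-SPACE digest `digest3Y = aggr (msort2 fuel contribs3Y)` is stated as data and verified in its own file together with the part's entry-wise check `wf3S`; the glue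
checks `runsOK` of the key-sorted concatenation of the digests (or of super-digests, two levels).  **`pos_of_digestsY`** / **`pos_of_superdigestsY`**: then the glued
certificate's ENUMERATED contribution list `contribs3S` evaluates nonnegatively at every nonnegative valuation — what `SymCert3.cut_of_posS3_count` consumes.
The type-space evaluation of a part needs only its entry-wise check (`evalC_contribs3Y_of_wf`).  No sorries.
-/

noncomputable section

namespace Summit.CriticalPhenomena.PercolationContinuityZ3.Theorems

namespace HubOnly
namespace QCert
namespace SymCert3

variable (c : SymCert3)

/-- The entry-wise check delivers the hypotheses of the per-entry soundness lemmas. -/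
theorem wf3S_entries (h : c.wf3S = true) :
    (∀ e ∈ c.ell2, e.1 < c.NV ∧ e.2.1 < c.NV) ∧ (∀ e ∈ c.lin, e.1 < c.base.m ∧ e.2.1 < c.NV ∧ e.2.2.1 < c.NV) ∧
      (∀ ch ∈ c.rows, ∀ r ∈ ch, c.base.rowOK r.row = true ∧ r.t < c.NV) := by
  unfold wf3S at h
  simp only [Bool.and_eq_true, List.all_eq_true, decide_eq_true_eq] at h
  obtain ⟨⟨⟨he, hl⟩, hr⟩, _⟩ := h
  exact ⟨fun e he' => he e he', fun e he' => ⟨(hl e he').1.1, (hl e he').1.2, (hl e he').2⟩, fun ch hch r hr' => hr ch hch r hr'⟩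

/-- **Type-space evaluation of a part** (entry-wise check only). -/
theorem evalC_contribs3Y_of_wf (hw : c.wf3S = true) (val : ℕ → ℝ) : evalC val c.contribs3Y = evalC val c.contribs3S := by
  obtain ⟨he, hl, hr⟩ := c.wf3S_entries hw
  unfold contribs3Y contribs3S
  rw [evalC_append, evalC_append, evalC_append, evalC_append, evalC_append, evalC_append]
  have e1 : evalC val (c.ell2.map c.ell2Y).flatten = evalC val (c.ell2.map c.ell2C).flatten :=
    evalC_flatten_congr val _ _ _ fun e hm => (c.evalC_ell2Y val e (he e hm).1 (he e hm).2).symm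
  have e2 : evalC val (c.lin.map c.linY).flatten = evalC val (c.lin.map c.linC3).flatten :=
    evalC_flatten_congr val _ _ _ fun e hm => (c.evalC_linY val e (hl e hm).1 (hl e hm).2.1 (hl e hm).2.2).symm
  have e3 : evalC val (c.rows.map fun ch => (ch.map c.rowY).flatten).flatten = evalC val (c.rows.map fun ch => (ch.map c.rowC3S).flatten).flatten :=
    evalC_flatten_congr val _ _ _ fun ch hch => evalC_flatten_congr val _ _ _ fun r hr' => (c.evalC_rowY val r (hr ch hch r hr').1 (hr ch hch r hr').2).symm
  rw [e1, e2, e3]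

/-- **The type-space digest of a (partial) certificate.** -/
def digest3Y (fuel : ℕ) : List (ℕ × ℤ) := aggr (msort2 fuel c.contribs3Y)

/-- The digest evaluates like the enumerated contribution list (entry-wise check). -/
theorem evalC_digest3Y (hw : c.wf3S = true) (fuel : ℕ) (val : ℕ → ℝ) : evalC val (c.digest3Y fuel) = evalC val c.contribs3S := by
  unfold digest3Y
  rw [evalC_aggr, evalC_perm val (msort2_perm fuel _), c.evalC_contribs3Y_of_wf hw]

/-- The parts' enumerated values are their type-space digests' values. -/
theorem map_evalC_of_digestsY (fuel : ℕ) (val : ℕ → ℝ) {l : List SymCert3} {D : List (List (ℕ × ℤ))}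
    (hw : ∀ d ∈ l, d.wf3S = true) (hD : List.Forall₂ (fun d dg => d.digest3Y fuel = dg) l D) :
    (l.map fun d => evalC val d.contribs3S) = D.map (evalC val) := by
  induction hD with
  | nil => rfl
  | @cons d dg l' D' hdg _ ih =>
    rw [List.map_cons, List.map_cons, ih fun d' hd' => hw d' (List.mem_cons_of_mem _ hd'), ← hdg, evalC_digest3Y d (hw d (by simp))]

/-- **NONNEGATIVITY FROM TYPE-SPACE DIGESTS (one level).** -/
theorem pos_of_digestsY (b : Cert) (l : List SymCert3) (hb : ∀ d ∈ l, d.base = b) (hw : ∀ d ∈ l, d.wf3S = true) (fuel : ℕ)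
    (D : List (List (ℕ × ℤ))) (hD : List.Forall₂ (fun d dg => d.digest3Y fuel = dg) l D) (hruns : runsOK (msort2 fuel D.flatten) = true)
    (val : ℕ → ℝ) (hval : ∀ key, 0 ≤ val key) : 0 ≤ evalC val (concat b l).contribs3S := by
  rw [evalC_concat3 b val l hb, map_evalC_of_digestsY fuel val hw hD, ← evalC_flatten]
  exact evalC_nonneg_of_runsOK_msort2 val hval fuel _ hruns

/-- **NONNEGATIVITY FROM TYPE-SPACE DIGESTS, two levels** (groups' super-digests as in `…QCertSym3Glue`). -/
theorem pos_of_superdigestsY (b : Cert) (l : List SymCert3) (hb : ∀ d ∈ l, d.base = b) (hw : ∀ d ∈ l, d.wf3S = true) (fuel : ℕ)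
    (D : List (List (ℕ × ℤ))) (hD : List.Forall₂ (fun d dg => d.digest3Y fuel = dg) l D) (G : List (List (List (ℕ × ℤ)))) (hG : G.flatten = D)
    (E : List (List (ℕ × ℤ))) (hE : List.Forall₂ (fun g e => aggr (msort2 fuel g.flatten) = e) G E)
    (hruns : runsOK (msort2 fuel E.flatten) = true) (val : ℕ → ℝ) (hval : ∀ key, 0 ≤ val key) :
    0 ≤ evalC val (concat b l).contribs3S := by
  rw [evalC_concat3 b val l hb, map_evalC_of_digestsY fuel val hw hD, ← evalC_flatten, ← hG, evalC_flatten_flatten,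
    map_evalC_of_superdigests fuel val hE, ← evalC_flatten]
  exact evalC_nonneg_of_runsOK_msort2 val hval fuel _ hruns

/-- Smoke test (kernel): the type-space digest of the `(2,1)` smoke certificate. -/
theorem sym3Smoke_digestY : sym3Smoke.digest3Y 8 = sym3Smoke.digest3 8 := by decide +kernel

end SymCert3
end QCert
end HubOnly

end Summit.CriticalPhenomena.PercolationContinuityZ3.Theorems

end
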